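import Summits.QuantumFields.YangMills.Theorems.BalabanUVNodesN08HaarCompatibilitySecondOrderDefect

/-!
# BalabanUVNodes ∕ N08 — E6′ HOLDS TO SECOND ORDER IN THE GUARD ACTIVITY: below the top level, for every set `A` of coarse fields,
# `|Ū_*(dU)(A) − dV(A)| ≤ 2·n²·h(δ)^{2(L^{d−1}−1)}` (`n` = number of coarse bonds) — the first-order defect of print's averaging CANCELS EXACTLY, because the isolated
# guard is invisible both for the typed averaging (part 38B) and for the axial one (part 45A)

WIDTH SEAT `pub-ymgap-dag-n08-w3` g7, item-3 lineage PART 45B (successor of g0 `…HaarCompatibilityGuard` («E6′ up to total variation `dU(guard)`», FIRST order `≈ n·q`), of part 34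
`…GuardHybridPartition` (guard-set decomposition) and of part 45A `…SecondOrderDefect`), 2026-08-28.  Track A, DAG node N08 = [Balaban1985UV3] Thm 1 p. 257 (compact) + Thm 2 p. 272;
key item K1⁷ `StabilityBAtRecordR13SepCoPH` (stmt-QuantumFields-20542), `--supports … --as helper`.  COUNT-NEUTRAL.

THE POINT (E6′ desk + road (ii); located, count-neutral).  Decompose `dU = Σ_S dU↾E_S` by the exact guard set `E_S = {guards = S}` (part 34); push forward along print's `Ū`
(`= Ū^S` on `E_S`) and along the axial averaging (Haar compatible: `Σ_S (dU↾E_S)∘axial⁻¹ = dV`).  Term by term (§1 `term_le_term_add`, MEASURE inequalities): `S = ∅` — identical;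
`|S| ≥ 2` — each term bounded by the other plus itself; `S = {c}` — `dU↾G_c = dU↾E_c + dU↾(G_c ∖ E_c)` and BOTH `dU↾G_c`-images are `dU(G_c) • dV` (parts 38B ∕ 45A), so the singleton
terms differ by an image of `dU↾(G_c ∩ M₂)`.  Summing (§1 `map_avgFun_le_add_and_le`: error MEASURES of mass `Σ_S d_S ≤ 2n²q²`, part 45A) and evaluating (§1 ★★★ `map_avgFun_sub_le_sq`):
  **`Ū_*(dU)(A) ≤ dV(A) + 2·n²·h(δ)^{2(L^{d−1}−1)}` and `dV(A) ≤ Ū_*(dU)(A) + 2·n²·h(δ)^{2(L^{d−1}−1)}` for EVERY set `A`.**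
§2: the slot (`avOfPrint N S₀ j` on `SU(N)`, every `N`, `q = h(δ_N)^{L^{d−1}−1}`).  READING: the one-step E6′ defect is `O(n²q²)`, not `O(nq)`; for the no-stacking bookkeeping the
density excess of the floored iterate after one step from `dU` has total mass `O(n²q²)`.

HONEST FRAMING.  [folklore] measure theory over landed modules; nothing of Bałaban's asserted; E6′ NEITHER proved NOR refuted (a second-order total-variation bound); ONE RG step —
NO (G3), NO k-uniform `hmass`; N08 NOT discharged; counts unmoved (typed 28∕28 · discharged 5∕27); one finite 𝕋⁴ programme at fixed ε — R4 closes the CONDITIONAL rung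
`BalabanLadder.UV` only; the Yang–Mills mass gap (Clay) is NOT proved by any of this; nothing continuum ∕ ℝ⁴ ∕ OS.  0 `sorry`, 0 `def`, 0 `instance`, standard axioms.
-/

noncomputable section

open MeasureTheory
open scoped ENNReal

namespace Summit.QuantumFields.YangMills.BalabanUVNodes.N08HaarCompatibilitySecondOrder

open Literature.MathematicalPhysics.QuantumFieldTheory.Balaban1983to89
open Literature.MathematicalPhysics.QuantumFieldTheory.Balaban1983to89.AveragingRT (axialAvg measurable_axialAvg map_axialAvg)
open Literature.MathematicalPhysics.QuantumFieldTheory.Balaban1983to89.BlockAveraging (Small avgFun measurable_avgFun)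
open Summit.QuantumFields.Balaban3D.Proofs
open Summit.QuantumFields.YangMills.BalabanUVNodes.N08HaarCompatibilityGuardHybridPartition
  (measurable_hybrid measurableSet_guardAll measurableSet_guardEq eq_sum_restrict_guardEq map_avgFun_eq_sum_map_hybrid)
open Summit.QuantumFields.YangMills.BalabanUVNodes.N08HaarCompatibilityGuardHybridIsolatedGuard (map_restrict_guard_hybrid_singleton)
open Summit.QuantumFields.YangMills.BalabanUVNodes.N08HaarCompatibilitySecondOrderDefect (hybrid_empty_eq_axialAvg map_restrict_guard_axialAvg_singleton sum_defect_le)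

variable {P : Params} {j : ℕ} {G : Type} [GaugeGroup G] (ℰ : LoopAverage G) [DecidableEq (PBond P (j + 1))] [MeasurableSpace G] [RegularGaugeGroup G] [HaarData G]

/-! ## §1 E6′ to second order -/

/-- **Term-by-term comparison (measure level)**: for every guard set `S`,
`(dU↾E_S)∘(Ū^S)⁻¹ ≤ (dU↾E_S)∘axial⁻¹ + X_S` and `(dU↾E_S)∘axial⁻¹ ≤ (dU↾E_S)∘(Ū^S)⁻¹ + Y_S` with error measures of mass `d_S` (`sum_defect_le`): `0` for `S = ∅` (`Ū^∅ = axial`),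
the images of `dU↾(G_c ∩ M₂)` for `S = {c}` (§1 and part 38B: both `dU↾G_c`-images are `dU(G_c) • dV`), the terms themselves for `|S| ≥ 2`.
[cite: Balaban1987RG1, (2.1) p.265 + (0.4) p.253 (bookkeeping — NOT in print)] -/
theorem term_le_term_add (hlt : j + 1 < P.m + P.K) (hE : ∀ n, Measurable fun W : Fin (n + 1) → G => ℰ.E W) (S : Finset (PBond P (j + 1))) :
    ((fieldMeasure P j G).restrict {U : GaugeField P j G | ∀ c, Small ℰ U c ↔ c ∈ S}).map
          (fun U => (fun c => if c ∈ S then avgFun ℰ U c else axialAvg U c : GaugeField P (j + 1) G)) ≤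
        ((fieldMeasure P j G).restrict {U : GaugeField P j G | ∀ c, Small ℰ U c ↔ c ∈ S}).map (axialAvg : GaugeField P j G → GaugeField P (j + 1) G) +
          (if S = ∅ then 0 else if S.card = 1 then
            ((fieldMeasure P j G).restrict ({W : GaugeField P j G | ∀ c' ∈ S, Small ℰ W c'} ∩
              {W : GaugeField P j G | ∃ c₁ c₂ : PBond P (j + 1), c₁ ≠ c₂ ∧ Small ℰ W c₁ ∧ Small ℰ W c₂})).map (axialAvg : GaugeField P j G → GaugeField P (j + 1) G)
          else ((fieldMeasure P j G).restrict {U : GaugeField P j G | ∀ c, Small ℰ U c ↔ c ∈ S}).map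
            (fun U => (fun c => if c ∈ S then avgFun ℰ U c else axialAvg U c : GaugeField P (j + 1) G))) ∧
    ((fieldMeasure P j G).restrict {U : GaugeField P j G | ∀ c, Small ℰ U c ↔ c ∈ S}).map (axialAvg : GaugeField P j G → GaugeField P (j + 1) G) ≤
        ((fieldMeasure P j G).restrict {U : GaugeField P j G | ∀ c, Small ℰ U c ↔ c ∈ S}).map
            (fun U => (fun c => if c ∈ S then avgFun ℰ U c else axialAvg U c : GaugeField P (j + 1) G)) +
          (if S = ∅ then 0 else if S.card = 1 then
            ((fieldMeasure P j G).restrict ({W : GaugeField P j G | ∀ c' ∈ S, Small ℰ W c'} ∩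
              {W : GaugeField P j G | ∃ c₁ c₂ : PBond P (j + 1), c₁ ≠ c₂ ∧ Small ℰ W c₁ ∧ Small ℰ W c₂})).map
              (fun U => (fun c => if c ∈ S then avgFun ℰ U c else axialAvg U c : GaugeField P (j + 1) G))
          else ((fieldMeasure P j G).restrict {U : GaugeField P j G | ∀ c, Small ℰ U c ↔ c ∈ S}).map (axialAvg : GaugeField P j G → GaugeField P (j + 1) G)) := by
  haveI := HaarData.isProb (G := G)
  have hj : j + 1 ≤ P.m + P.K := hlt.le
  have hHm : Measurable fun U : GaugeField P j G => (fun c => if c ∈ S then avgFun ℰ U c else axialAvg U c : GaugeField P (j + 1) G) := measurable_hybrid ℰ hE S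
  have hXm : Measurable (axialAvg : GaugeField P j G → GaugeField P (j + 1) G) := measurable_axialAvg
  have hE_S := measurableSet_guardEq ℰ (P := P) (j := j) (G := G) S
  by_cases h0 : S = ∅
  · -- `Ū^∅ = axial`
    subst h0
    simp only [if_true, add_zero, hybrid_empty_eq_axialAvg]
    exact ⟨le_rfl, le_rfl⟩
  simp only [if_neg h0]
  by_cases h1 : S.card = 1
  · -- the singleton: both restricted-to-`G_c` images are `dU(G_c) • dV`
    simp only [if_pos h1]
    obtain ⟨c, rfl⟩ := Finset.card_eq_one.1 h1
    have hG := measurableSet_guardAll ℰ (P := P) (j := j) (G := G) ({c} : Finset (PBond P (j + 1)))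
    set E : Set (GaugeField P j G) := {U : GaugeField P j G | ∀ c', Small ℰ U c' ↔ c' ∈ ({c} : Finset (PBond P (j + 1)))} with hEdef
    set Gc : Set (GaugeField P j G) := {W : GaugeField P j G | ∀ c' ∈ ({c} : Finset (PBond P (j + 1))), Small ℰ W c'} with hGc
    set M₂ : Set (GaugeField P j G) := {W : GaugeField P j G | ∃ c₁ c₂ : PBond P (j + 1), c₁ ≠ c₂ ∧ Small ℰ W c₁ ∧ Small ℰ W c₂} with hM₂
    have hEG : E ⊆ Gc := fun U hU c' hc' => (hU c').2 hc'
    have hdiff : Gc \ E ⊆ Gc ∩ M₂ := by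
      rintro U ⟨hUG, hUE⟩
      refine ⟨hUG, ?_⟩
      have hc : Small ℰ U c := hUG c (Finset.mem_singleton_self c)
      by_contra hM
      refine hUE fun c' => ⟨fun hc' => ?_, fun hc' => hUG c' hc'⟩
      rw [Finset.mem_singleton]
      by_contra hne
      exact hM ⟨c', c, hne, hc', hc⟩
    -- name the six measures (all typed on `GaugeField P (j+1) G`)
    set TE : Measure (GaugeField P (j + 1) G) := ((fieldMeasure P j G).restrict E).map
      (fun U => (fun c' => if c' ∈ ({c} : Finset (PBond P (j + 1))) then avgFun ℰ U c' else axialAvg U c' : GaugeField P (j + 1) G)) with hTE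
    set TD : Measure (GaugeField P (j + 1) G) := ((fieldMeasure P j G).restrict (Gc \ E)).map
      (fun U => (fun c' => if c' ∈ ({c} : Finset (PBond P (j + 1))) then avgFun ℰ U c' else axialAvg U c' : GaugeField P (j + 1) G)) with hTD
    set TM : Measure (GaugeField P (j + 1) G) := ((fieldMeasure P j G).restrict (Gc ∩ M₂)).map
      (fun U => (fun c' => if c' ∈ ({c} : Finset (PBond P (j + 1))) then avgFun ℰ U c' else axialAvg U c' : GaugeField P (j + 1) G)) with hTM
    set RE : Measure (GaugeField P (j + 1) G) := ((fieldMeasure P j G).restrict E).map (axialAvg : GaugeField P j G → GaugeField P (j + 1) G) with hRE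
    set RD : Measure (GaugeField P (j + 1) G) := ((fieldMeasure P j G).restrict (Gc \ E)).map (axialAvg : GaugeField P j G → GaugeField P (j + 1) G) with hRD
    set RM : Measure (GaugeField P (j + 1) G) := ((fieldMeasure P j G).restrict (Gc ∩ M₂)).map (axialAvg : GaugeField P j G → GaugeField P (j + 1) G) with hRM
    -- `dU↾Gc = dU↾E + dU↾(Gc \ E)` and `dU↾(Gc \ E) ≤ dU↾(Gc ∩ M₂)`
    have hsplit : (fieldMeasure P j G).restrict Gc = (fieldMeasure P j G).restrict E + (fieldMeasure P j G).restrict (Gc \ E) := by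
      rw [← Measure.restrict_union Set.disjoint_sdiff_right (hG.diff hE_S), Set.union_sdiff_cancel hEG]
    have hmono : (fieldMeasure P j G).restrict (Gc \ E) ≤ (fieldMeasure P j G).restrict (Gc ∩ M₂) := Measure.restrict_mono hdiff le_rfl
    have hYle : TD ≤ TM := Measure.map_mono hmono hHm
    have hXle : RD ≤ RM := Measure.map_mono hmono hXm
    -- the two constant images (part 38B and part 45A)
    have hT : TE + TD = fieldMeasure P j G Gc • fieldMeasure P (j + 1) G := by
      have e := Measure.map_add ((fieldMeasure P j G).restrict E) ((fieldMeasure P j G).restrict (Gc \ E)) hHm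
      rw [← hsplit] at e
      exact e.symm.trans (map_restrict_guard_hybrid_singleton ℰ hlt hE c)
    have hR : RE + RD = fieldMeasure P j G Gc • fieldMeasure P (j + 1) G := by
      have e := Measure.map_add ((fieldMeasure P j G).restrict E) ((fieldMeasure P j G).restrict (Gc \ E)) hXm
      rw [← hsplit] at e
      exact e.symm.trans (map_restrict_guard_axialAvg_singleton ℰ hlt hE c)
    constructor
    · calc TE ≤ TE + TD := Measure.le_add_right le_rfl
        _ = RE + RD := hT.trans hR.symm
        _ ≤ RE + RM := add_le_add le_rfl hXle
    · calc RE ≤ RE + RD := Measure.le_add_right le_rfl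
        _ = TE + TD := hR.trans hT.symm
        _ ≤ TE + TM := add_le_add le_rfl hYle
  · -- `|S| ≥ 2`: the terms themselves
    simp only [if_neg h1]
    exact ⟨Measure.le_add_left le_rfl, Measure.le_add_left le_rfl⟩

omit [RegularGaugeGroup G] in
/-- The masses of the error measures are the `d_S` of `sum_defect_le` (plumbing). [folklore] -/
theorem errorMass_eq (S : Finset (PBond P (j + 1))) (F : GaugeField P j G → GaugeField P (j + 1) G)
    (hF : Measurable F) (F' : GaugeField P j G → GaugeField P (j + 1) G) (hF' : Measurable F') :
    (if S = ∅ then (0 : Measure (GaugeField P (j + 1) G)) else if S.card = 1 then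
        ((fieldMeasure P j G).restrict ({W : GaugeField P j G | ∀ c' ∈ S, Small ℰ W c'} ∩
          {W : GaugeField P j G | ∃ c₁ c₂ : PBond P (j + 1), c₁ ≠ c₂ ∧ Small ℰ W c₁ ∧ Small ℰ W c₂})).map F
      else ((fieldMeasure P j G).restrict {U : GaugeField P j G | ∀ c, Small ℰ U c ↔ c ∈ S}).map F') Set.univ =
      (if S = ∅ then (0 : ℝ≥0∞) else if S.card = 1 then
        fieldMeasure P j G ({W : GaugeField P j G | ∀ c' ∈ S, Small ℰ W c'} ∩ {W : GaugeField P j G | ∃ c₁ c₂ : PBond P (j + 1), c₁ ≠ c₂ ∧ Small ℰ W c₁ ∧ Small ℰ W c₂})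
      else fieldMeasure P j G {W : GaugeField P j G | ∀ c', Small ℰ W c' ↔ c' ∈ S}) := by
  by_cases h0 : S = ∅
  · simp only [h0, if_true, Measure.coe_zero, Pi.zero_apply]
  · simp only [if_neg h0]
    by_cases h1 : S.card = 1
    · simp only [if_pos h1]
      rw [Measure.map_apply hF MeasurableSet.univ, Set.preimage_univ, Measure.restrict_apply_univ]
    · simp only [if_neg h1]
      rw [Measure.map_apply hF' MeasurableSet.univ, Set.preimage_univ, Measure.restrict_apply_univ]

/-- ★★★ **E6′ TO SECOND ORDER (measure form)**: below the top level, `Ū_*(dU) ≤ dV + X` and `dV ≤ Ū_*(dU) + Y` with error measures of total mass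
`≤ 2·n²·h(δ)^{2(L^{d−1}−1)}` (`n = #PBond(j+1)`), for print's (0.4) averaging `Ū = avgFun ℰ` with any measurable small-loop average.
[cite: Balaban1987RG1, (2.1) p.265 + (0.4) p.253; Balaban1985Averaging, (10)+(15) p.19 (bookkeeping — E6′ NOT in print)] -/
theorem map_avgFun_le_add_and_le (hlt : j + 1 < P.m + P.K) (hE : ∀ n, Measurable fun W : Fin (n + 1) → G => ℰ.E W) :
    ∃ X Y : Measure (GaugeField P (j + 1) G),
      X Set.univ ≤ 2 * (Fintype.card (PBond P (j + 1)) : ℝ≥0∞) ^ 2 * (HaarData.haar : Measure G) {g : G | dist1 g < ℰ.δ} ^ (2 * (P.L ^ (P.d - 1) - 1)) ∧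
      Y Set.univ ≤ 2 * (Fintype.card (PBond P (j + 1)) : ℝ≥0∞) ^ 2 * (HaarData.haar : Measure G) {g : G | dist1 g < ℰ.δ} ^ (2 * (P.L ^ (P.d - 1) - 1)) ∧
      (fieldMeasure P j G).map (avgFun ℰ) ≤ fieldMeasure P (j + 1) G + X ∧ fieldMeasure P (j + 1) G ≤ (fieldMeasure P j G).map (avgFun ℰ) + Y := by
  have hj : j + 1 ≤ P.m + P.K := hlt.le
  have hHm : ∀ S : Finset (PBond P (j + 1)), Measurable fun U : GaugeField P j G => (fun c => if c ∈ S then avgFun ℰ U c else axialAvg U c : GaugeField P (j + 1) G) :=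
    fun S => measurable_hybrid ℰ hE S
  have hXm : Measurable (axialAvg : GaugeField P j G → GaugeField P (j + 1) G) := measurable_axialAvg
  -- the four families, typed on `GaugeField P (j+1) G`
  set T : Finset (PBond P (j + 1)) → Measure (GaugeField P (j + 1) G) := fun S =>
    ((fieldMeasure P j G).restrict {U : GaugeField P j G | ∀ c, Small ℰ U c ↔ c ∈ S}).map
      (fun U => (fun c => if c ∈ S then avgFun ℰ U c else axialAvg U c : GaugeField P (j + 1) G)) with hTdef
  set R : Finset (PBond P (j + 1)) → Measure (GaugeField P (j + 1) G) := fun S =>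
    ((fieldMeasure P j G).restrict {U : GaugeField P j G | ∀ c, Small ℰ U c ↔ c ∈ S}).map (axialAvg : GaugeField P j G → GaugeField P (j + 1) G) with hRdef
  set X : Finset (PBond P (j + 1)) → Measure (GaugeField P (j + 1) G) := fun S =>
    if S = ∅ then 0 else if S.card = 1 then
      ((fieldMeasure P j G).restrict ({W : GaugeField P j G | ∀ c' ∈ S, Small ℰ W c'} ∩
        {W : GaugeField P j G | ∃ c₁ c₂ : PBond P (j + 1), c₁ ≠ c₂ ∧ Small ℰ W c₁ ∧ Small ℰ W c₂})).map (axialAvg : GaugeField P j G → GaugeField P (j + 1) G)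
    else ((fieldMeasure P j G).restrict {U : GaugeField P j G | ∀ c, Small ℰ U c ↔ c ∈ S}).map
      (fun U => (fun c => if c ∈ S then avgFun ℰ U c else axialAvg U c : GaugeField P (j + 1) G)) with hXdef
  set Y : Finset (PBond P (j + 1)) → Measure (GaugeField P (j + 1) G) := fun S =>
    if S = ∅ then 0 else if S.card = 1 then
      ((fieldMeasure P j G).restrict ({W : GaugeField P j G | ∀ c' ∈ S, Small ℰ W c'} ∩
        {W : GaugeField P j G | ∃ c₁ c₂ : PBond P (j + 1), c₁ ≠ c₂ ∧ Small ℰ W c₁ ∧ Small ℰ W c₂})).map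
          (fun U => (fun c => if c ∈ S then avgFun ℰ U c else axialAvg U c : GaugeField P (j + 1) G))
    else ((fieldMeasure P j G).restrict {U : GaugeField P j G | ∀ c, Small ℰ U c ↔ c ∈ S}).map (axialAvg : GaugeField P j G → GaugeField P (j + 1) G) with hYdef
  have hT : (fieldMeasure P j G).map (avgFun ℰ) = ∑ S, T S := map_avgFun_eq_sum_map_hybrid ℰ hE (fieldMeasure P j G)
  have hR : fieldMeasure P (j + 1) G = ∑ S, R S := by
    rw [hRdef, ← N08HaarCompatibilityGuardHybridPartition.map_finset_sum measurable_axialAvg, ← eq_sum_restrict_guardEq ℰ (fieldMeasure P j G)]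
    exact (map_axialAvg hj).symm
  have hterm : ∀ S, T S ≤ R S + X S ∧ R S ≤ T S + Y S := fun S => term_le_term_add ℰ hlt hE S
  have hXmass : ∀ S, X S Set.univ = (if S = ∅ then (0 : ℝ≥0∞) else if S.card = 1 then
      fieldMeasure P j G ({W : GaugeField P j G | ∀ c' ∈ S, Small ℰ W c'} ∩ {W : GaugeField P j G | ∃ c₁ c₂ : PBond P (j + 1), c₁ ≠ c₂ ∧ Small ℰ W c₁ ∧ Small ℰ W c₂})
      else fieldMeasure P j G {W : GaugeField P j G | ∀ c', Small ℰ W c' ↔ c' ∈ S}) := fun S => errorMass_eq ℰ S _ hXm _ (hHm S)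
  have hYmass : ∀ S, Y S Set.univ = (if S = ∅ then (0 : ℝ≥0∞) else if S.card = 1 then
      fieldMeasure P j G ({W : GaugeField P j G | ∀ c' ∈ S, Small ℰ W c'} ∩ {W : GaugeField P j G | ∃ c₁ c₂ : PBond P (j + 1), c₁ ≠ c₂ ∧ Small ℰ W c₁ ∧ Small ℰ W c₂})
      else fieldMeasure P j G {W : GaugeField P j G | ∀ c', Small ℰ W c' ↔ c' ∈ S}) := fun S => errorMass_eq ℰ S _ (hHm S) _ hXm
  refine ⟨∑ S, X S, ∑ S, Y S, ?_, ?_, ?_, ?_⟩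
  · rw [Measure.finsetSum_apply]
    exact (le_of_eq (Finset.sum_congr rfl fun S _ => hXmass S)).trans (sum_defect_le ℰ hj)
  · rw [Measure.finsetSum_apply]
    exact (le_of_eq (Finset.sum_congr rfl fun S _ => hYmass S)).trans (sum_defect_le ℰ hj)
  · rw [hT, hR, ← Finset.sum_add_distrib]
    exact Finset.sum_le_sum fun S _ => (hterm S).1
  · rw [hT, hR, ← Finset.sum_add_distrib]
    exact Finset.sum_le_sum fun S _ => (hterm S).2

/-- ★★★ **E6′ TO SECOND ORDER**: below the top level, for EVERY set `A` of coarse fields, `Ū_*(dU)(A) ≤ dV(A) + 2·n²·h(δ)^{2(L^{d−1}−1)}` and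
`dV(A) ≤ Ū_*(dU)(A) + 2·n²·h(δ)^{2(L^{d−1}−1)}` — versus the first-order `dU(guard) ≈ n·h(δ)^{L^{d−1}−1}` of `…HaarCompatibilityGuard`.
[cite: Balaban1987RG1, (2.1) p.265 + (0.4) p.253; Balaban1985Averaging, (10)+(15) p.19 (bookkeeping — E6′ NOT in print)] -/
theorem map_avgFun_sub_le_sq (hlt : j + 1 < P.m + P.K) (hE : ∀ n, Measurable fun W : Fin (n + 1) → G => ℰ.E W) (A : Set (GaugeField P (j + 1) G)) :
    (fieldMeasure P j G).map (avgFun ℰ) A ≤ fieldMeasure P (j + 1) G A +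
        2 * (Fintype.card (PBond P (j + 1)) : ℝ≥0∞) ^ 2 * (HaarData.haar : Measure G) {g : G | dist1 g < ℰ.δ} ^ (2 * (P.L ^ (P.d - 1) - 1)) ∧
    fieldMeasure P (j + 1) G A ≤ (fieldMeasure P j G).map (avgFun ℰ) A +
        2 * (Fintype.card (PBond P (j + 1)) : ℝ≥0∞) ^ 2 * (HaarData.haar : Measure G) {g : G | dist1 g < ℰ.δ} ^ (2 * (P.L ^ (P.d - 1) - 1)) := by
  obtain ⟨X, Y, hX, hY, h1, h2⟩ := map_avgFun_le_add_and_le ℰ hlt hE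
  constructor
  · calc (fieldMeasure P j G).map (avgFun ℰ) A ≤ (fieldMeasure P (j + 1) G + X) A := h1 A
      _ = fieldMeasure P (j + 1) G A + X A := Measure.add_apply _ _ _
      _ ≤ _ := add_le_add le_rfl ((measure_mono (Set.subset_univ A)).trans hX)
  · calc fieldMeasure P (j + 1) G A ≤ ((fieldMeasure P j G).map (avgFun ℰ) + Y) A := h2 A
      _ = (fieldMeasure P j G).map (avgFun ℰ) A + Y A := Measure.add_apply _ _ _
      _ ≤ _ := add_le_add le_rfl ((measure_mono (Set.subset_univ A)).trans hY)

/-! ## §2 At the [B10] slot's averaging `avOfPrint N S₀ j` on `SU(N)` -/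

section Slot

open Literature.MathematicalPhysics.QuantumFieldTheory.Balaban1985CMP102.Setting (Scales)
open Literature.MathematicalPhysics.QuantumFieldTheory.Balaban1983to89.B10RunsOfRecord (avOfPrint)
open Literature.MathematicalPhysics.QuantumFieldTheory.Balaban1983to89.ExpMeanLog (expMeanLogSU expMeanLogSU_δ measurable_expMeanLogSU_E)
open Literature.MathematicalPhysics.QuantumFieldTheory.Balaban1983to89.Node00 (SU)
open Summit.QuantumFields.YangMills.BalabanUVNodes.N08HaarCompatibilityGuard (avOfPrint_avg_of_le)

variable (N : ℕ) [NeZero N] {L : ℕ}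

/-- ★★★ **E6′ TO SECOND ORDER AT THE SLOT** (every `N`, below the top level): for every measurable `A`,
`|(avOfPrint N S₀ j)_*(dU)(A) − dV(A)| ≤ 2·n²·h(δ_N)^{2(L^{d−1}−1)}`, `δ_N = min(1∕3, π∕N)`, `n = #PBond(j+1)` — versus g0's first-order `dU(guard) ≈ n·h(δ_N)^{L^{d−1}−1}`.
[cite: Balaban1985UV3, (2) p.256; Balaban1987RG1, (2.1) p.265 + (0.4) p.253 (bookkeeping — E6′ NOT in print)] -/
theorem map_avOfPrint_sub_le_sq (S₀ : Scales L) {j : ℕ} (hlt : j + 1 < S₀.P.m + S₀.P.K) [DecidableEq (PBond S₀.P (j + 1))] (A : Set (GaugeField S₀.P (j + 1) (SU N))) :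
    (fieldMeasure S₀.P j (SU N)).map (avOfPrint N S₀ j).avg A ≤ fieldMeasure S₀.P (j + 1) (SU N) A +
        2 * (Fintype.card (PBond S₀.P (j + 1)) : ℝ≥0∞) ^ 2 * (HaarData.haar : Measure (SU N)) {g : SU N | dist1 g < min (1 / 3) (Real.pi / N)} ^ (2 * (S₀.P.L ^ (S₀.P.d - 1) - 1)) ∧
    fieldMeasure S₀.P (j + 1) (SU N) A ≤ (fieldMeasure S₀.P j (SU N)).map (avOfPrint N S₀ j).avg A +
        2 * (Fintype.card (PBond S₀.P (j + 1)) : ℝ≥0∞) ^ 2 * (HaarData.haar : Measure (SU N)) {g : SU N | dist1 g < min (1 / 3) (Real.pi / N)} ^ (2 * (S₀.P.L ^ (S₀.P.d - 1) - 1)) := by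
  rw [avOfPrint_avg_of_le N S₀ hlt.le]
  have h := map_avgFun_sub_le_sq (expMeanLogSU : LoopAverage (SU N)) hlt measurable_expMeanLogSU_E A
  rw [expMeanLogSU_δ, Fintype.card_fin] at h
  exact h

end Slot

end Summit.QuantumFields.YangMills.BalabanUVNodes.N08HaarCompatibilitySecondOrder

end
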